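import Mathlib
import Literature.NumberTheory.EllipticCurves.IwasawaAlgebra

/-!
# Genus-character Kronecker residue — the algebra of THEOREM G (bsd-idea-20 g57, crux workfile)

Crux `EllipticUnitValueSevenOfGZK` (stmt-BirchSwinnertonDyer-19945), research statement K2
`ResidualNonvanishingSeven` (`KatoMuAbelianResidueSketch.lean`): `z₀ ∉ augIdealP 7 • ⊤`.
Memo of record: `GenusResidue-g57.md` (REV 1.1).  This file proves NO summit statement and NO route
item; it kernel-checks the ALGEBRA of the memo's §3, with every number-theoretic input an explicit
hypothesis, so that a reader can see exactly what the paper argument consumes: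

* `residue_vanishes_of_mem_smul_top`, `not_mem_smul_top_of_residue` (§3 (G7), last step): a
  `Λ`-linear RESIDUE FUNCTIONAL `ℓ : 𝐇 → N` into a module killed by `p` and torsion-free over the
  prime `P ∋ p` detects `p`-indivisibility: if `b • x = a • Z` with `a ∉ P` and `ℓ Z ≠ 0` then
  `x ∉ (p) • 𝐇`.  In the memo `x = z₀` (tree-admissible class, (G1): `z₀ ∈ Λ_{(7)}ˣ · z^K`),
  `Z = Z_𝔞 = (N𝔞 − σ_𝔞)·z^K(W₁)` (Kato's integral elliptic-unit class, (15.16.1)), `ℓ` = (genus–Kummer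
  isomorphism (T-c)) ∘ (localisation at 7) ∘ (residue mod `φ̂_* 𝐇(T₃)`), followed by Coleman's map
  mod 7, landing in `Ω = Λ ⧸ (7) = 𝔽₇⟦T⟧`.
* `smul_eq_zero_quotient`, `torsionFree_quotient_of_isPrime`: `N = Λ ⧸ P` qualifies when `P` is
  prime (tree fact name `Literature.…IwasawaAlgebra.isPrime_augIdealP`, taken as a hypothesis).
* `mk_mul_mul_ne_zero` (§3 (G6)): the value `ℓ Z = c₁ · G_𝔞 · g_{η₁} mod 7` is non-zero because each
  factor is `μ`-free: `c₁` a 7-unit (G3′), `G_𝔞 = c₀ (N𝔞 − σ_𝔞) Θ_{η₃}` (Kato (15.6.4) + Stickelberger,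
  Ferrero–Washington for the ODD genus partner `η₃ = ω²χ_D`), `g_{η₁}` (Kubota–Leopoldt series of the
  EVEN character `η₁ = ω⁵χ_D`, Coleman/Iwasawa–Gillard–Tsuji + Ferrero–Washington).
* `coleman_detects` (§3 (G6), CLAIM): if the `η₁`-elliptic unit `θ = G • ξ` were `p`-divisible in the
  semi-local units then `Col θ = G * Col ξ ∈ (p)` — so `μ(G g) = 0` forbids it.
* `plusClass_not_mem_pullback` (§2 (G2), COHOMOLOGICAL bookkeeping; since REV 1.1 a consistency
  check only): with `φ^* γ⁺₃ = a γ⁺₁`, `7 ∣ a` (the structural period identity (S4)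
  `|c_φ| Ω⁺₁ = 7 Ω⁺₃`), the cohomology class `γ⁺₁ ∈ H¹(W₁(ℂ), ℤ)⁺` is not in
  `φ^* H¹(W₃, ℤ) + 7 H¹(W₁, ℤ)`.  (In HOMOLOGY the parity is opposite: `γ⁺₁ = 7 γ⁺₃ ∈ π T₇W₁`;
  Poincaré duality swaps `c`-parity.  REV 1.1 of the memo no longer uses either statement as an
  input — see `k2_transfer_of_split`.)
* `k2_transfer_of_split` (memo REV 1.1, LEMMA L — TRANSFER FROM THE SPLIT VERTEX): in
  `𝒱' = V(f) ⊗ K_𝔭` the `G_ℚ`-stable `O_𝔭`-lattices are the split vertex `S' = Ind T_ψ` (Kato §15.11)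
  and the two non-split neighbours `L'^±` (`π S' ⊂ L'^± ⊂ S'`), up to homothety; every member `W` of
  the isogeny class has `H¹_et(W, ℤ₇) ⊗ O_𝔭 = π^k L'^±` inside its split hull `S'_W = π^k S'`, and its
  cohomology-plus generator is `γ_W = u • π^a • γ_{S'_W}⁺` with `a ∈ {0, 1}` (`H¹(⟨c⟩, ·) = 0`,
  `7` odd).  Since `𝐇'` is functorial and `π`-torsion-free and Kato's `γ ↦ 𝐳_γ` is `K_𝔭`-linear,
  `𝐳_{γ_{S'}⁺} ∉ π • 𝐇'(S')` implies `𝐳_{γ_W} ∉ 7 • 𝐇'(T_W)` for EVERY member (`7 = v π²`): K2 on the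
  whole class follows from the single split-vertex statement (K2_S), which is what the genus residue
  proves.  No period identity, no parity of a twisting element and no isogeny lift (L3) is consumed.
* `k2_of_genusResidue_seven`: the composition in the crux's currency `Λ = IwasawaAlgebra 7`,
  `(7) = augIdealP 7`, concluding `z₀ ∉ augIdealP 7 • ⊤` — the literal shape of
  `ResidualNonvanishingSeven W … z₀` — from the residue functional, its non-vanishing on `Z_𝔞`, and (G1).

Nothing here is specific to `p = 7` except the last section.
-/

open Pointwise

set_option linter.dupNamespace false

namespace Summit.BirchSwinnertonDyer.BirchSwinnertonDyer.Cruxes.EllipticUnitValueSevenOfGZK.GenusResidue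

section residueFunctional

variable {R : Type*} [CommRing R] {M N : Type*} [AddCommGroup M] [Module R M]
  [AddCommGroup N] [Module R N]

/-- `x ∈ (p) • ⊤ ↔ x = p • w` (bridge to the crux's currency). -/
theorem mem_span_singleton_smul_top_iff (p : R) (x : M) :
    x ∈ (Ideal.span {p} : Ideal R) • (⊤ : Submodule R M) ↔ ∃ w : M, x = p • w := by
  rw [Submodule.ideal_span_singleton_smul, Submodule.mem_smul_pointwise_iff_exists]
  constructor
  · rintro ⟨b, -, rfl⟩
    exact ⟨b, rfl⟩
  · rintro ⟨w, rfl⟩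
    exact ⟨w, Submodule.mem_top, rfl⟩

/-- A residue functional into a module killed by `p` vanishes on `(p) • ⊤`. -/
theorem residue_vanishes_of_mem_smul_top (ℓ : M →ₗ[R] N) (p : R) (hpN : ∀ n : N, p • n = 0)
    {x : M} (hx : x ∈ (Ideal.span {p} : Ideal R) • (⊤ : Submodule R M)) : ℓ x = 0 := by
  obtain ⟨w, rfl⟩ := (mem_span_singleton_smul_top_iff p x).1 hx
  rw [map_smul]
  exact hpN (ℓ w)

/-- **(G7), last step.** If `b • x = a • Z` with `a ∉ P`, the residue target `N` is killed by `p` and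
is `P`-torsion-free (`a • n = 0 → a ∈ P ∨ n = 0`), and the residue `ℓ Z ≠ 0`, then `x ∉ (p) • ⊤`. -/
theorem not_mem_smul_top_of_residue (P : Ideal R) (p : R) (ℓ : M →ₗ[R] N)
    (hpN : ∀ n : N, p • n = 0) (hN : ∀ (a : R) (n : N), a • n = 0 → a ∈ P ∨ n = 0)
    {a b : R} (ha : a ∉ P) {x Z : M} (hxZ : b • x = a • Z) (hZ : ℓ Z ≠ 0) :
    x ∉ (Ideal.span {p} : Ideal R) • (⊤ : Submodule R M) := by
  intro hx
  have h1 : ℓ (b • x) = 0 := by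
    rw [map_smul, residue_vanishes_of_mem_smul_top ℓ p hpN hx, smul_zero]
  have h2 : a • ℓ Z = 0 := by
    rw [← map_smul, ← hxZ]
    exact h1
  rcases hN a (ℓ Z) h2 with h | h
  · exact ha h
  · exact hZ h

end residueFunctional

section quotientTarget

variable {R : Type*} [CommRing R]

/-- `p ∈ P` kills `R ⧸ P`. -/
theorem smul_eq_zero_quotient (P : Ideal R) {p : R} (hp : p ∈ P) (n : R ⧸ P) : p • n = 0 := by
  obtain ⟨m, rfl⟩ := Ideal.Quotient.mk_surjective n
  rw [Algebra.smul_def, Ideal.Quotient.algebraMap_eq, ← map_mul, Ideal.Quotient.eq_zero_iff_mem]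
  exact P.mul_mem_right m hp

/-- `R ⧸ P` is `P`-torsion-free when `P` is prime. -/
theorem torsionFree_quotient_of_isPrime (P : Ideal R) (hP : P.IsPrime) (a : R) (n : R ⧸ P)
    (h : a • n = 0) : a ∈ P ∨ n = 0 := by
  obtain ⟨m, rfl⟩ := Ideal.Quotient.mk_surjective n
  rw [Algebra.smul_def, Ideal.Quotient.algebraMap_eq, ← map_mul, Ideal.Quotient.eq_zero_iff_mem] at h
  rcases hP.mem_or_mem h with h | h
  · exact Or.inl h
  · exact Or.inr (Ideal.Quotient.eq_zero_iff_mem.2 h)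

/-- **(G6) value.** A product of `μ`-free (= not in the prime `P`) factors is non-zero mod `P`:
`ℓ Z = c₁ · G_𝔞 · g_{η₁} mod 7 ≠ 0`. -/
theorem mk_mul_mul_ne_zero (P : Ideal R) (hP : P.IsPrime) {c G g : R} (hc : c ∉ P) (hG : G ∉ P)
    (hg : g ∉ P) : Ideal.Quotient.mk P (c * G * g) ≠ 0 := by
  rw [Ne, Ideal.Quotient.eq_zero_iff_mem]
  intro h
  rcases hP.mem_or_mem h with h | h
  · rcases hP.mem_or_mem h with h | h
    · exact hc h
    · exact hG h
  · exact hg h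

end quotientTarget

section coleman

variable {R : Type*} [CommRing R] {U : Type*} [AddCommGroup U] [Module R U]

/-- **(G6) CLAIM.** Coleman's map detects `p`-divisibility of the `η₁`-elliptic unit: with the genus
factorisation `θ = G • ξ` (G5) and `Col ξ = g` (Iwasawa–Gillard–Tsuji), `p`-divisibility of `θ` in
the semi-local units forces `G * g ∈ (p)`, i.e. `μ(G g) ≥ 1`. -/
theorem coleman_detects (Col : U →ₗ[R] R) {θ ξ : U} {G g p : R} (hθ : θ = G • ξ) (hξ : Col ξ = g)
    (hdiv : ∃ y : U, θ = p • y) : G * g ∈ (Ideal.span {p} : Ideal R) := by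
  obtain ⟨y, hy⟩ := hdiv
  have h1 : Col θ = G * g := by rw [hθ, map_smul, hξ, smul_eq_mul]
  have h2 : Col θ = p * Col y := by rw [hy, map_smul, smul_eq_mul]
  rw [← h1, h2]
  exact Ideal.mul_mem_right _ _ (Ideal.mem_span_singleton_self p)

/-- Contrapositive in the form the memo uses: `μ(G g) = 0` (here: `G * g ∉ P ⊇ (p)`) ⟹ `θ` is not
`p`-divisible, so its Kummer image mod `p` — the genus residue `R` — is non-zero. -/
theorem not_divisible_of_mu_free (P : Ideal R) (hP : P.IsPrime) (Col : U →ₗ[R] R) {θ ξ : U}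
    {G g p : R} (hp : p ∈ P) (hθ : θ = G • ξ) (hξ : Col ξ = g) (hG : G ∉ P) (hg : g ∉ P) :
    ¬ ∃ y : U, θ = p • y := by
  intro hdiv
  have hmem : G * g ∈ P := by
    have := coleman_detects Col hθ hξ hdiv
    exact (Ideal.span_singleton_le_iff_mem _ |>.2 hp) this
  rcases hP.mem_or_mem hmem with h | h
  · exact hG h
  · exact hg h

end coleman

section betti

/-- **(G2).** In `H¹(W₁(ℂ), ℤ) = ℤγ⁺₁ ⊕ ℤγ⁻₁` (up to the 7-unit index 2), the pull-back lattice
`φ^* H¹(W₃, ℤ)` is spanned by `a γ⁺₁` and `b γ⁻₁`; the structural period identity (S4) gives `7 ∣ a`.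
Then `γ⁺₁ ∉ φ^* H¹(W₃, ℤ) + 7 H¹(W₁, ℤ)`: looking at the `γ⁺₁`-coordinate, `1 = m a + 7 u` is
impossible.  Hence the twisting element `s₁` of the a-type member is non-zero mod `𝔭`. -/
theorem plusClass_not_mem_pullback {a : ℤ} (ha : (7 : ℤ) ∣ a) :
    ¬ ∃ m u : ℤ, (1 : ℤ) = m * a + 7 * u := by
  rintro ⟨m, u, h⟩
  obtain ⟨k, rfl⟩ := ha
  have h7 : (7 : ℤ) ∣ 1 := ⟨m * k + u, by linear_combination h⟩
  exact absurd h7 (by norm_num)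

/-- The b-type counterpart: with `φ̂^* γ⁺₁ = a' γ⁺₃`, `a a' = ±7` and `7 ∣ a` force `a' = ±1`, so
`γ⁺₃ ∈ φ̂^* H¹(W₁, ℤ)`: the b-type twisting element DIES mod `𝔭` (`μ = 1` exactly at `E_{D,3}`). -/
theorem bType_coefficient_unit {a a' : ℤ} (ha : (7 : ℤ) ∣ a) (h : a * a' = 7 ∨ a * a' = -7) :
    a' = 1 ∨ a' = -1 := by
  obtain ⟨k, rfl⟩ := ha
  rcases h with h | h
  · have h1 : a' * k = 1 :=
      mul_left_cancel₀ (by norm_num : (7 : ℤ) ≠ 0) (by linear_combination h)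
    exact Int.eq_one_or_neg_one_of_mul_eq_one h1
  · have h1 : (-a') * k = 1 :=
      mul_left_cancel₀ (by norm_num : (7 : ℤ) ≠ 0) (by linear_combination -h)
    rcases Int.eq_one_or_neg_one_of_mul_eq_one h1 with h2 | h2
    · exact Or.inr (by linear_combination -h2)
    · exact Or.inl (by linear_combination -h2)

end betti

section latticeTransfer

variable {R : Type*} [CommRing R] {A : Type*} [AddCommGroup A] [Module R A]

/-- LEMMA L (memo REV 1.1 §1 (T-e) / §3 (G7′)): TRANSFER FROM THE SPLIT VERTEX, abstract form.
Instantiation: `R = Λ_{O_𝔭} = O_𝔭⟦Γ⟧`, `A = 𝐇'(𝒱')` (Iwasawa cohomology with `K_𝔭`-coefficients; no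
`π`-torsion because `H⁰(ℚ_∞, W[7]) = 0`), `HS = 𝐇'(S'_W)` (split hull of the member's lattice),
`HW = 𝐇'(H¹_et(W, ℤ₇) ⊗ O_𝔭) ≤ HS`, `zS = 𝐳_{γ_{S'_W}⁺}`, `zW = 𝐳_{γ_W} = u • π^a • zS` with `a ≤ 1`,
`7 = v * π²` (`v = -1` in `O_𝔭 = ℤ₇[√-7]`).  Conclusion: the admissible class of `W` is not
divisible by `7` in `𝐇'(T_W)` — i.e. K2 at `W` — as soon as the split-vertex element is
`π`-indivisible in `𝐇'(S')`.  Exponents for the two `7`-isogenous members: normalising the split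
hull of the a-type member `W₁` to `S'`, `H¹_et(W₁) ⊗ O_𝔭 = L'^+` reduces ONTO the `c`-even line, so
`γ_{W₁}` generates `S'⁺` (`a = 0`); the b-type member has `H¹_et(W₃) ⊗ O_𝔭 = π L'^-`, split hull
`π S'`, and `γ_{W₃} = ±7 γ_{W₁} = u' π • γ_{πS'}⁺` (`a = 1`).  The 2-isogenous members share the
lattices and generators up to `ℤ₇ˣ`. -/
theorem k2_transfer_of_split (π v u : R) (hu : IsUnit u) (hπ : ∀ x : A, π • x = 0 → x = 0)
    {HS HW : Submodule R A} (hWS : HW ≤ HS) {zS zW : A} {a : ℕ} (ha : a ≤ 1)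
    (hzW : zW = u • π ^ a • zS) (hS : ∀ h ∈ HS, zS ≠ π • h) :
    ∀ h ∈ HW, zW ≠ (v * π ^ 2) • h := by
  obtain ⟨w, rfl⟩ := hu
  intro h hh hcontra
  have hhS : h ∈ HS := hWS hh
  have key : ∀ y ∈ HS, (w : R) • zS = π • y → False := by
    intro y hy hwy
    have h2 := congrArg (fun x => ((w⁻¹ : Rˣ) : R) • x) hwy
    simp only [smul_smul, Units.inv_mul, one_smul] at h2
    refine hS (((w⁻¹ : Rˣ) : R) • y) (HS.smul_mem _ hy) ?_
    rw [h2, smul_smul, mul_comm]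
  rw [hzW] at hcontra
  interval_cases a
  · simp only [pow_zero, one_smul] at hcontra
    refine key ((v * π) • h) (HS.smul_mem _ hhS) ?_
    rw [hcontra, smul_smul]
    congr 1
    ring
  · simp only [pow_one] at hcontra
    have e1 : π • ((w : R) • zS) = (v * π ^ 2) • h := by
      rw [smul_smul, mul_comm, ← smul_smul]
      exact hcontra
    have h3 : π • ((w : R) • zS - (v * π) • h) = 0 := by
      rw [smul_sub, e1, smul_smul, sub_eq_zero]
      congr 1
      ring
    have h4 := hπ _ h3
    rw [sub_eq_zero] at h4
    refine key (v • h) (HS.smul_mem _ hhS) ?_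
    rw [h4, smul_smul, mul_comm v π]

end latticeTransfer

section treeCurrency

open Literature.NumberTheory.EllipticCurves Literature.NumberTheory.EllipticCurves.IwasawaAlgebra

/-- **K2 from the genus residue, in the crux's currency.** `Λ = IwasawaAlgebra 7`, `(7) = augIdealP 7`
(prime: tree fact `isPrime_augIdealP`, hypothesis `hP`), `H = I.H = 𝐇(T₇E_{D,1})`, `ℓ` the genus–Coleman
residue functional into `Λ ⧸ (7) = 𝔽₇⟦T⟧`, `Z = Z_𝔞` Kato's integral elliptic-unit class with
`ℓ Z ≠ 0` (THEOREM G), and (G1) in the form `b • z₀ = a • Z`, `a ∉ (7)`.  Conclusion: the literal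
shape of `ResidualNonvanishingSeven … z₀`. -/
theorem k2_of_genusResidue_seven [Fact (Nat.Prime 7)] {H : Type*} [AddCommGroup H]
    [Module (IwasawaAlgebra 7) H] (hP : (augIdealP 7).IsPrime)
    (ℓ : H →ₗ[IwasawaAlgebra 7] (IwasawaAlgebra 7 ⧸ augIdealP 7))
    {a b : IwasawaAlgebra 7} (ha : a ∉ augIdealP 7) {z₀ Z : H} (hxZ : b • z₀ = a • Z)
    (hZ : ℓ Z ≠ 0) :
    z₀ ∉ (augIdealP 7 • (⊤ : Submodule (IwasawaAlgebra 7) H)) := by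
  have hp : (PowerSeries.C (7 : ℤ_[7]) : IwasawaAlgebra 7) ∈ augIdealP 7 :=
    Ideal.mem_span_singleton_self _
  exact not_mem_smul_top_of_residue (augIdealP 7) (PowerSeries.C (7 : ℤ_[7]))
    ℓ (smul_eq_zero_quotient (augIdealP 7) hp) (torsionFree_quotient_of_isPrime (augIdealP 7) hP)
    ha hxZ hZ

/-- The value of the residue functional on Kato's class is non-zero as soon as the three factors are
`μ`-free (G3′)+(G6): packaged for the reader. -/
theorem residue_value_ne_zero_seven [Fact (Nat.Prime 7)] (hP : (augIdealP 7).IsPrime)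
    {c G g : IwasawaAlgebra 7} (hc : c ∉ augIdealP 7) (hG : G ∉ augIdealP 7)
    (hg : g ∉ augIdealP 7) : Ideal.Quotient.mk (augIdealP 7) (c * G * g) ≠ 0 :=
  mk_mul_mul_ne_zero (augIdealP 7) hP hc hG hg

end treeCurrency

end Summit.BirchSwinnertonDyer.BirchSwinnertonDyer.Cruxes.EllipticUnitValueSevenOfGZK.GenusResidue
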